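/-
Copyright: statement-level skeleton of a published paper (lit-balaban cell, Phase-2 proof seat p40 gen 71). No proof claims
beyond what the kernel checks below.
-/
import Literature.MathematicalPhysics.QuantumFieldTheory.Balaban1983to89.B3Eq322ZeroLattice
import Literature.MathematicalPhysics.QuantumFieldTheory.Balaban1983to89.B3Eq323ZeroLattice

/-!
# B3 — T. Bałaban, *(Higgs)₂,₃ quantum fields in a finite volume. III. Renormalization*, CMP **88** (1983) 411–445
[Balaban1983Higgs3], p. 439 [PDF 29], **(3.22) → (3.23) → "HENCE THE LAST GRAPH IN (3.22) DEFINES A VERTEX WITH SOME CONVERGENT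
FUNCTION", END TO END ON THE PRINT'S CARRIER** `ηℤ³`, zero external field: the sum over `j, j′ < k` of the second graphs of (3.21)
with lines the pieces `G^η_{(j)}(0)`, `G^η_{(j′)}(0)` of `G_k(0) = G_k(ηℤ³,0)`, minus the generalized (positive-degree) graphs of (3.22),
IS the local vertex (3.23) on `G_k(0)`, and that vertex is bounded by `(C₁ + C₂K′)·Σ_μΣ_xη³‖φ(x)‖‖q²(∂^η_μφ′)(x)‖` uniformly in `k` and the
window — the dictionary between this seat's two files `B3Eq322ZeroLattice` ((3.21)/(3.22)/(3.23)-body on `ηℤ^{d+1}`, p26's `KernelZ`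
vocabulary) and `B3Eq323ZeroLattice` (the (3.23)/(3.24) bounds on `ξℤ³`, p39's `GxiL` vocabulary) at `d + 1 = 3`

statement-level skeleton of published theorems with citation tags; proofs where landed; nothing here is a claim about
the Yang–Mills mass gap

PDF held: `paper:balaban1983-higgs-2-3-quantum-fields-finite-volume` (journal page = PDF page + 410); p. 439 [PDF 29] read in the OCR
text (`p0029.txt` of `lit read`) and on the ×2 render
`run/shared/lean/pub/pub-balaban/b2b-balaban-ref1/pages/1983-cmp88-higgs23-III/1983-cmp88-higgs23-III-p029-x2.png`.

CITATION HEADER (lean-in-tree rule).  Part of the lit-balaban TYPED SKELETON (HOME `run/shared/lean/pub/lit-balaban/`), Phase 2,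
proof seat p40 generation 71.  Row **B3.Eq3.21-3.24** of `HOME/lit-balaban-r15/ROWS-B3.md` (fold owner r15), residual (iii)
*"(3.22)/(3.23) WITH BODIES ON PRINT'S CARRIER ηℤ^d for G_{j″}(0) = G(ηℤ³,0)"*: F1 `B3Eq322ZeroLattice` (p348969) typed (3.21)/(3.22) and
the (3.23) body on `ηℤ^{d+1}` with p26's pieces `gpieceZ`/`GresumZ` (`B3Ineq314ZeroLattice`), F2 `B3Eq323ZeroLattice` (p350168) proved
the (3.23) bracket bounded on `ξℤ³` for p39's `GxiL` (`B3Eq316ResolventZeroLattice`).  THIS FILE identifies the two carriers at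
`d + 1 = 3` (`etaZ = xiOf`, `gpieceZ = pieceXi`, `GresumZ k = GxiL`, `d1KernelZ η⁻¹ = dK1 η`, finite-support brackets = the `ℤ³`
series) and states the end-to-end consequence.  Nothing of F1/F2/p26/p39 is restated; everything is used BY NAME.

THE PRINTED TEXT (p. 439 [PDF 29], verbatim).  *"(3.22) The first graph on the right side has positive degree, the second is treated
in the same way as the expression (3.15): we sum over proper orderings and j-indices and we get
Σ_{μ=1}^d Σ_x η^dφ(x)·[q²Σ_{x′}η^d(∂^η_μG^η_{j″}(0))(x,x′)g(x)G^η_{j″}(x,x′)g′(x′)](∂^η_μφ′)(x). (3.23) … Hence the last graph in (3.22)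
defines a vertex with some convergent function."*

WHAT IS PROVED (`d + 1 = 3`; `η = L^{−k}`; integer labels `Fin 3 → ℤ = ZSite 3`).
* §1 THE TWO CARRIERS AGREE: `etaZ_eq_xiOf` (`η` of p26 = `ξ` of p39 at `j″ = k`), `gpieceZ_eq_pieceXi` (p26's `η^{−3}`-normalised
  pieces = p39's `ξ³`-normalised pieces), **`GresumZ_top_eq_GxiL`** (`𝒢_k = η^{−3}G_k(0)` of F1 = `G^ξ_k(0)` of F2),
  `d1KernelZ_eq_dK1` (the two forward-difference kernels).
* §2 THE BRACKETS AGREE: for a localization `g′` supported in the finite set `Λ′`, F1's finite sum `bracket323Z … Λ′ x` EQUALS F2's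
  series `bracket323L … x` (`bracket323Z_eq_bracket323L`, any kernels, any `η`), and F1's `expr323Z` (leg derivative `pd η⁻¹ μ φ′`)
  EQUALS F2's `expr323L` with `D_μ = ∂^η_μφ′` (`expr323Z_eq_expr323L`).
* §3 **"HENCE THE LAST GRAPH IN (3.22) DEFINES A VERTEX WITH SOME CONVERGENT FUNCTION" FOR `G_k(0) = G_k(ηℤ³, 0)`**:
  **`exists_expr323Z_zeroLattice_bound`** — `∃ C₁ C₂ > 0` (on `L` and the window only) with, for every `k ≥ 1`, window point,
  `K′ ≥ 0`, `|g|,|g′| ≤ 1`, `g′` `K′`-Lipschitz for `η|·|_∞` and supported in `Λ′`, all `Λ, φ, φ′, q`: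
  `|expr323Z η q 𝒢_k 𝒢_k g g′ φ φ′ Λ Λ′| ≤ (C₁ + C₂K′)·Σ_μΣ_{x∈Λ}η³‖φ(x)‖‖q²(∂^η_μφ′)(x)‖` (F2's `exists_expr323L_GxiL_bound` through
  §§1–2); and **`sum_expr321bZ_sub_rem322Z_zeroLattice`** — combined with F1's `sum_expr321bZ_eq_zeroLattice` (`n = k`): the sum over
  `j, j′ < k` of the second graphs of (3.21) on the pieces of `G_k(0)` MINUS the generalized graphs `rem322Z[j,j′]` of (3.22) (each of
  positive degree, F1's `abs_rem322Z_le_zeroLattice`) is bounded by the same local vertex norm — (3.22)/(3.23) end to end on the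
  print's carrier.
HONEST SCOPE: `d + 1 = 3` only (F2 is written on `ℤ³`); zero external field, both lines the scalar `G_k(0)` pieces (F1/F2 scope); the
resummation index is the top one, `j″ = k` (`𝒢_k = G_k(0)`; for `n < k` F1's `GresumZ n` is p26's partial resummation, whose
identification with a rescaled coarser-step propagator is the (2.6)/(2.7) bookkeeping neither file re-derives); `g′` of finite support
(F1's brackets are finite sums over `Λ′`); the Lipschitz reading of `g′` as in F2.  NOT claimed: anything for `d + 1 = 2`, non-zero
backgrounds, the pictures.  Mathlib + the cited tree files only; theorems only, no new definitions, no named facts; standard axioms.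
Unit `lit-balaban-p40-g71` (Phase-2 proof seat p40, gen 71), HOME `run/shared/lean/pub/lit-balaban/`, 2026-08-23.
-/

open scoped BigOperators RealInnerProductSpace
open Finset

namespace Literature.MathematicalPhysics.QuantumFieldTheory.Balaban1983to89.B3Eq322VertexZeroLattice

open B3Sect3VectorSelfEnergy (ZSite unitVec)
open B3CxiUniformBound (supNorm)
open B3Eq316ResolventZeroLattice (xiOf GxiL xiOf_pos)
open B3Eq316DifferenceKernelBounds (dK1)
open B3Taylor310Lattice (pd)
open B3Ineq313Lattice (KernelZ)
open B3Ineq314ZeroLattice (etaZ gpieceZ GresumZ GresumZ_top)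
open B3Bound316ZeroLattice (pieceXi)
open B3Eq322ZeroLattice (d1KernelZ ker321Z bracket323Z expr323Z expr321bZ rem322Z sum_expr321bZ_eq_zeroLattice)
open B3Eq323ZeroLattice (term323 bracket323L expr323L exists_expr323L_GxiL_bound)

noncomputable section

/-! ## §1 The two carriers agree at `d + 1 = 3` -/

section Carriers

variable (ℓ k : ℕ) (a m2 : ℝ)

/-- kernel: p26's spacing `η = L^{−k}` (`etaZ`, a cast natural power) is p39's `ξ = L^{−k}` (`xiOf`).
[cite: Balaban1983Higgs3, (3.23) p.439] -/
theorem etaZ_eq_xiOf : etaZ ℓ k = xiOf ℓ k := by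
  simp only [etaZ, xiOf, Nat.cast_pow, Nat.cast_add, Nat.cast_one]

/-- kernel: p26's `η^{−3}`-normalised pieces `G^η_{(j)}(0)` on `ℤ³` are p39's `ξ³`-normalised pieces (both `(L^k)³·pieceLat j`).
[cite: Balaban1983Higgs3, (2.6) p.424] -/
theorem gpieceZ_eq_pieceXi (j : ℕ) : gpieceZ (d := 2) ℓ k j a m2 = pieceXi ℓ k j a m2 := by
  funext x x'
  simp only [gpieceZ, pieceXi, Nat.cast_pow, Nat.cast_add, Nat.cast_one]

/-- **THE RESUMMED PROPAGATOR OF F1 IS THE PROPAGATOR OF F2**: `𝒢_k = η^{−3}G_k(0)` (p26's `GresumZ ℓ k k`, top index) equals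
`G^ξ_k(0)` (p39's `GxiL ℓ k`) as kernels on `ℤ³` — both are `(L^k)³·GkLat`. [cite: Balaban1983Higgs3, (2.6) p.424] -/
theorem GresumZ_top_eq_GxiL : GresumZ (d := 2) ℓ k k a m2 = GxiL ℓ k a m2 := by
  funext x x'
  rw [GresumZ_top]
  simp only [GxiL, Nat.cast_pow, Nat.cast_add, Nat.cast_one]

/-- kernel: F1's forward-difference kernel `d1KernelZ η⁻¹ μ` is F2's `dK1 η μ` (`e_μ = Pi.single μ 1`).
[cite: Balaban1983Higgs3, (3.23) p.439] -/
theorem d1KernelZ_eq_dK1 (η : ℝ) (μ : Fin 3) (G : KernelZ 2) : d1KernelZ (d := 2) η⁻¹ μ G = dK1 η μ G := by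
  funext x x'
  simp only [d1KernelZ, dK1, unitVec]

end Carriers

/-! ## §2 The finite-support brackets of F1 are the `ℤ³` series of F2 -/

section Brackets

variable {W : Type*} [NormedAddCommGroup W] [InnerProductSpace ℝ W]

/-- **F1's SQUARE BRACKET OF (3.23) = F2's**: for a localization `g′` supported in the finite set `Λ′`, the finite sum
`Σ_{x′∈Λ′}η³(∂^η_μG0)(x,x′)g(x)G(x,x′)g′(x′)` equals the series over `ℤ³` (every kernel pair, every `η`).
[cite: Balaban1983Higgs3, (3.23) p.439] -/
theorem bracket323Z_eq_bracket323L (η : ℝ) (μ : Fin 3) (G0 G : KernelZ 2) (g : (Fin 3 → ℤ) → ℝ) {g' : (Fin 3 → ℤ) → ℝ}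
    {Λ' : Finset (Fin 3 → ℤ)} (hg' : ∀ x, x ∉ Λ' → g' x = 0) (x : Fin 3 → ℤ) :
    bracket323Z (d := 2) η μ G0 G g g' Λ' x = bracket323L η μ G0 G g g' x := by
  unfold bracket323L
  rw [tsum_eq_sum (s := Λ') (fun x' hx' => by simp [term323, hg' x' hx'])]
  unfold bracket323Z
  refine Finset.sum_congr rfl fun x' _ => ?_
  simp only [ker321Z, term323, ← d1KernelZ_eq_dK1]

/-- **F1's (3.23) = F2's (3.23)**: with the leg derivative `D_μ = ∂^η_μφ′` (`pd η⁻¹ μ φ′`) and `g′` supported in `Λ′`,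
`expr323Z η q G0 G g g′ φ φ′ Λ Λ′ = expr323L η q G0 G g g′ Λ φ D`. [cite: Balaban1983Higgs3, (3.23) p.439] -/
theorem expr323Z_eq_expr323L (η : ℝ) (q : W →ₗ[ℝ] W) (G0 G : KernelZ 2) (g : (Fin 3 → ℤ) → ℝ) {g' : (Fin 3 → ℤ) → ℝ}
    (φ φ' : (Fin 3 → ℤ) → W) (Λ : Finset (Fin 3 → ℤ)) {Λ' : Finset (Fin 3 → ℤ)} (hg' : ∀ x, x ∉ Λ' → g' x = 0) :
    expr323Z (d := 2) η q G0 G g g' φ φ' Λ Λ' = expr323L η q G0 G g g' Λ φ (fun μ x => pd η⁻¹ μ φ' x) := by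
  unfold expr323Z expr323L
  refine Finset.sum_congr rfl fun μ _ => Finset.sum_congr rfl fun x _ => ?_
  rw [bracket323Z_eq_bracket323L η μ G0 G g hg' x]

end Brackets

/-! ## §3 *"Hence the last graph in (3.22) defines a vertex with some convergent function"* for `G_k(0) = G_k(ηℤ³, 0)` -/

section EndToEnd

variable {W : Type*} [NormedAddCommGroup W] [InnerProductSpace ℝ W]

/-- **THE VERTEX (3.23) ON THE RESUMMED ZERO-LATTICE PROPAGATOR IS BOUNDED** (F1's object, F2's bound): there are `C₁, C₂ > 0`
(functions of `L` and the window `[a₋,a₊] × [0,m²₊]`) such that for every `k ≥ 1`, window point, `K′ ≥ 0`, localizations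
`|g|, |g′| ≤ 1` with `g′` `K′`-Lipschitz for the physical sup distance `η|x − x′|_∞` and supported in `Λ′`, every `Λ`, legs `φ, φ′`
and charge matrix `q`: `|expr323Z η q 𝒢_k 𝒢_k g g′ φ φ′ Λ Λ′| ≤ (C₁ + C₂K′)·Σ_μΣ_{x∈Λ}η³‖φ(x)‖·‖q²(∂^η_μφ′)(x)‖`
(`𝒢_k = GresumZ ℓ k k = η^{−3}G_k(0)`, `η = etaZ ℓ k`). [cite: Balaban1983Higgs3, (3.23) p.439] -/
theorem exists_expr323Z_zeroLattice_bound {ℓ : ℕ} (hℓ : 1 ≤ ℓ) (amin aplus m2plus : ℝ) (ha : 0 < amin) :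
    ∃ C₁ C₂ : ℝ, 0 < C₁ ∧ 0 < C₂ ∧ ∀ (k : ℕ), 1 ≤ k → ∀ (a m2 : ℝ), amin ≤ a → a ≤ aplus → 0 ≤ m2 → m2 ≤ m2plus →
      ∀ (K' : ℝ), 0 ≤ K' → ∀ (g g' : (Fin 3 → ℤ) → ℝ), (∀ x, |g x| ≤ 1) → (∀ x, |g' x| ≤ 1) →
        (∀ y y' : Fin 3 → ℤ, |g' y' - g' y| ≤ K' * (etaZ ℓ k * (supNorm (y - y') : ℝ))) →
        ∀ (Λ Λ' : Finset (Fin 3 → ℤ)), (∀ x, x ∉ Λ' → g' x = 0) →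
        ∀ (q : W →ₗ[ℝ] W) (φ φ' : (Fin 3 → ℤ) → W),
          |expr323Z (d := 2) (etaZ ℓ k) q (GresumZ ℓ k k a m2) (GresumZ ℓ k k a m2) g g' φ φ' Λ Λ'| ≤
            (C₁ + C₂ * K') * ∑ μ : Fin 3, ∑ x ∈ Λ, etaZ ℓ k ^ 3 * (‖φ x‖ * ‖q (q (pd (etaZ ℓ k)⁻¹ μ φ' x))‖) := by
  obtain ⟨C₁, C₂, hC₁, hC₂, h⟩ := exists_expr323L_GxiL_bound (W := W) hℓ amin aplus m2plus ha
  refine ⟨C₁, C₂, hC₁, hC₂, ?_⟩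
  intro k hk a m2 ha1 ha2 hm1 hm2 K' hK' g g' hg hg' hlip Λ Λ' hsupp q φ φ'
  rw [expr323Z_eq_expr323L _ q _ _ g φ φ' Λ hsupp, GresumZ_top_eq_GxiL, etaZ_eq_xiOf]
  rw [etaZ_eq_xiOf] at hlip
  exact h k hk a m2 ha1 ha2 hm1 hm2 K' hK' g g' hg hg' hlip q Λ φ (fun μ x => pd (xiOf ℓ k)⁻¹ μ φ' x)

/-- **(3.22)/(3.23) END TO END ON THE PRINT'S CARRIER**: with the constants of `exists_expr323Z_zeroLattice_bound`, for every `k ≥ 1`,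
window point and data as there, the sum over `j, j′ < k` of the second graphs of (3.21) with lines `G^η_{(j)}(0)`, `G^η_{(j′)}(0)`
MINUS the generalized graphs `rem322Z[j,j′]` of (3.22) (each of positive degree: F1's `abs_rem322Z_le_zeroLattice`) is the vertex
(3.23) on `G_k(0)` (F1's `sum_expr321bZ_eq_zeroLattice`, `n = k`) and is therefore bounded by
`(C₁ + C₂K′)·Σ_μΣ_{x∈Λ}η³‖φ(x)‖·‖q²(∂^η_μφ′)(x)‖` — *"the last graph in (3.22) defines a vertex with some convergent function"*.
[cite: Balaban1983Higgs3, (3.22)–(3.23) p.439] -/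
theorem sum_expr321bZ_sub_rem322Z_zeroLattice {ℓ : ℕ} (hℓ : 1 ≤ ℓ) (amin aplus m2plus : ℝ) (ha : 0 < amin) :
    ∃ C₁ C₂ : ℝ, 0 < C₁ ∧ 0 < C₂ ∧ ∀ (k : ℕ), 1 ≤ k → ∀ (a m2 : ℝ), amin ≤ a → a ≤ aplus → 0 ≤ m2 → m2 ≤ m2plus →
      ∀ (K' : ℝ), 0 ≤ K' → ∀ (g g' : (Fin 3 → ℤ) → ℝ), (∀ x, |g x| ≤ 1) → (∀ x, |g' x| ≤ 1) →
        (∀ y y' : Fin 3 → ℤ, |g' y' - g' y| ≤ K' * (etaZ ℓ k * (supNorm (y - y') : ℝ))) →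
        ∀ (Λ Λ' : Finset (Fin 3 → ℤ)), (∀ x, x ∉ Λ' → g' x = 0) →
        ∀ (q : W →ₗ[ℝ] W) (φ φ' : (Fin 3 → ℤ) → W),
          |(∑ j ∈ Finset.range k, ∑ j' ∈ Finset.range k,
              expr321bZ (etaZ ℓ k) q (gpieceZ (d := 2) ℓ k j a m2) (gpieceZ ℓ k j' a m2) g g' φ φ' Λ Λ') -
            ∑ j ∈ Finset.range k, ∑ j' ∈ Finset.range k,
              rem322Z (etaZ ℓ k) q (gpieceZ (d := 2) ℓ k j a m2) (gpieceZ ℓ k j' a m2) g g' φ φ' Λ Λ'| ≤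
            (C₁ + C₂ * K') * ∑ μ : Fin 3, ∑ x ∈ Λ, etaZ ℓ k ^ 3 * (‖φ x‖ * ‖q (q (pd (etaZ ℓ k)⁻¹ μ φ' x))‖) := by
  obtain ⟨C₁, C₂, hC₁, hC₂, h⟩ := exists_expr323Z_zeroLattice_bound (W := W) hℓ amin aplus m2plus ha
  refine ⟨C₁, C₂, hC₁, hC₂, ?_⟩
  intro k hk a m2 ha1 ha2 hm1 hm2 K' hK' g g' hg hg' hlip Λ Λ' hsupp q φ φ'
  rw [sum_expr321bZ_eq_zeroLattice (ℓ := ℓ) (a := a) (m2 := m2) hk le_rfl q g g' φ φ' Λ Λ', add_sub_cancel_left]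
  exact h k hk a m2 ha1 ha2 hm1 hm2 K' hK' g g' hg hg' hlip Λ Λ' hsupp q φ φ'

end EndToEnd

end

end Literature.MathematicalPhysics.QuantumFieldTheory.Balaban1983to89.B3Eq322VertexZeroLattice
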